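import Summits.QuantumFields.BalabanUV.Beta.EriceFlowEnclosureB12AsPrintedHistoryContagionShiftFlowZero
import Summits.QuantumFields.BalabanUV.Beta.EriceFlowEnclosureB12AsPrintedHistoryContagionShiftFlowPicardPin

/-!
# Beta / EriceFlowEnclosureB12AsPrintedHistoryContagionShiftFlowZeroOffset — ASYMPTOTIC FREEDOM IS CONTAGIOUS, part 34: THE CHART OFFSET OF TWO TRAJECTORIES NEAR ZERO
# PIN CONVERGES — THE RELATIVE Λ-PARAMETER OF THE FLOW WITH MEMORY, FLOOR-FREE, FROM ONE REFERENCE (the function of the pin and its Abel equation: part 35).  Two box solutions h, h′ of `MemFlow B · ·` from small pins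
# `e ≤ e′` are, in the chart, within `[(2∕3)Δ₀, (4∕3)Δ₀]` of each other at EVERY scale (part 14, `Δ₀ = 1∕e² − 1∕e′²`).  §55: the chart offset
# `D(n) = 1∕h(n)² − 1∕h′(n)²` CONVERGES — its increments are `B(h(n+1+·)) − B(h′(n+1+·))`, the couplings differ by `≤ (4∕3)Δ₀·c_n³` with the common envelope
# `c_n = (1∕(2e′)² + β*n∕4)^{−1∕2}`, and `c_{n+1}³ ≤ (8∕β*)(c_n − c_{n+1})` telescopes: **`|D(N) − D(n)| ≤ (32C_m∕(3(1 − θ)β*))·Δ₀·c_n`** (`abs_disc_sub_disc_le`), so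
# **`D(n) → Θ`** with `(2∕3)Δ₀ ≤ Θ ≤ (4∕3)Δ₀` and the rate `|Θ − D(n)| ≤ K·Δ₀·c_n` (`exists_relativeLambda`) — THE RELATIVE Λ-PARAMETER of the two trajectories: NO floor on
# the box, memory functional of ANY profile, ONE asymptotically free reference (d4-p2's (E52c) `…FunctionalShiftLargeLimit.exists_tendsto_disc_large_init` has it for ANY
# two solutions GIVEN a floor on the whole box, with the constant `2e^{6M∕(b√b)}`; near zero pin the constants are (2∕3, 4∕3)).  Also (§55 `succ_le_of_reference_flow`): near zero
# pin EVERY box solution DECREASES scale by scale (`h(m+1) < h(m) ≤ e`) — the memory term reads a tail below 2e, where part 32's derived floor `β₀ − 2C_m e∕(1 − θ) ≥ β₀ − β*∕2`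
# is positive.
# Abstract in B (β-flow team, prover 1, unit `b2b-balaban-beta-bflow-p1`, gen 39; ROW AP-I·Uc × ROW Λ × NODE U2 — the Λ-parameter near zero pin, kernel)

HONEST FRAMING (page 1 of everything the β sub-cell writes): discharging `BetaPertH` makes Bałaban's UV stability UNCONDITIONAL — a
real constructive-QFT result; it is NOT the continuum limit and NOT the Clay problem.  HONEST DEPENDENCY (cell reorg 2026-08-19,
verbatim): «continuum YM on T⁴ ⇐ BetaPertH ∧ nine spine estimates (0/9 proved); BetaPertH ⇐ (D1) ∧ (D4) ∧ CAP+tail; G-an2-4 gates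
asym, D1 and NE2/3/4.»  THIS MODULE DISCHARGES NOTHING: elementary real analysis (a telescoping cube sum, a Cauchy sequence, the intermediate value theorem) over node
U2's HYPOTHESIS SHAPES `T4BetaStationary.{SeqBox, MemoryProfile}`, `T4BetaFlowWellPosed.{MemFlow, solution}` on an ABSTRACT functional `B`; part 14's
`sep_twoSided_of_reference_flow`, part 10's `invSq_lower_of_reference_flow ∕ le_two_mul_pin_of_reference_flow`, part 32's `valueAtZero_sub_le ∕ rate_le_valueAtZero ∕
tail_le_invSprof`, part 25's `exists_tail_scale_le`, node U2's `T4CouplingMatching.abs_sub_le_of_inv_sq ∕ sprof ∕ sprof_sq_diff` BY NAME — nothing restated.  PRECEDENTS (by name, not imported): ROW Λ (#35 `EriceFlowEnclosureLambdaParameter.lambda_exists`,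
the MARKOV recursion (3.62) of ONE function β under clause (L)); d4-p2's AUTONOMY row (E51)–(E53) (`…FunctionalShiftLargeLimit`, `…RelativeLambdaInterval`: relative Λ,
continuity, order, compact-interval image — GIVEN a floor `b > 0` on the whole box and a zeroth moment; in a uniqueness regime).  Here: NO floor, the box ARBITRARY against
the profile, ONE AF reference.  `ScaleShiftRate` (GAPS G-t4-U2-1), `HistLipschitz`∕`FadingMemory` (G-t4-U2-2), [I] THEOREM 2 (p. 259, STATED WITHOUT PROOF) do not occur in
this abstract part (carrier END: part 36); NOTHING is asserted about Bałaban's β; «Λ-parameter» is this file's READING, not print.  [I] = T. Bałaban, Commun. Math. Phys. **109** (1987) 249–301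
[Balaban1987RG1].

WHAT THIS FILE PROVES (0 sorry, 0 def): §55 `package_of_le`, `le_envelope_of_reference_flow`, **`succ_le_of_reference_flow`** (solutions near zero pin DECREASE),
`abs_sub_le_cube`, `cube_le_telescope`, `abs_disc_succ_sub_le`, **`abs_disc_sub_disc_le`**, **`exists_relativeLambda`**.  NOT CLAIMED: the Λ-function of the pin and its Abel
equation (part 35); an ABSOLUTE Λ (`lim (1∕h(n)² − nβ₀)` — false at this generality, part 37); anything about Bałaban's β; `BetaPertH`; continuum; Clay.
-/

namespace Summit.QuantumFields.BalabanUV.Beta.EriceFlowEnclosureB12AsPrintedHistoryContagionShiftFlowZeroOffset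

open Finset Filter Topology Set
open Literature.MathematicalPhysics.QuantumFieldTheory.Balaban1983to89
open Literature.MathematicalPhysics.QuantumFieldTheory.Balaban1983to89.T4CouplingMatching (prof sprof sprof_pos sprof_sq prof_pos sprof_zero abs_sub_le_of_inv_sq)
open Literature.MathematicalPhysics.QuantumFieldTheory.Balaban1983to89.T4BetaStationary (SeqBox MemoryProfile summable_profile)
open Literature.MathematicalPhysics.QuantumFieldTheory.Balaban1983to89.T4BetaFlowWellPosed (MemFlow solution seqBox_shift one_div_sq_one_div_sqrt)
open Summit.QuantumFields.BalabanUV.Beta.EriceFlowEnclosureB12AsPrintedHistoryContagion (sprof_le_sprof)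
open Summit.QuantumFields.BalabanUV.Beta.EriceRemainderEnclosureHistoryAutonomyOrder (memFlow_tail)
open Summit.QuantumFields.BalabanUV.Beta.EriceFlowEnclosureB12AsPrintedHistoryContagionShiftFlow (invSq_lower_of_reference_flow)
open Summit.QuantumFields.BalabanUV.Beta.EriceFlowEnclosureB12AsPrintedHistoryContagionShiftFlowPicardLimit (memFlow_solution_of_reference
  eq_solution_of_memFlow_of_reference)
open Summit.QuantumFields.BalabanUV.Beta.EriceFlowEnclosureB12AsPrintedHistoryContagionShiftFlowPicardPin (sep_twoSided_of_reference_flow)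
open Summit.QuantumFields.BalabanUV.Beta.EriceFlowEnclosureB12AsPrintedHistoryContagionShiftFlowRepin (le_of_profile)
open Summit.QuantumFields.BalabanUV.Beta.EriceFlowEnclosureB12AsPrintedHistoryContagionShiftFlowRepinTail (one_div_sprof_pos exists_tail_scale_le)
open Summit.QuantumFields.BalabanUV.Beta.EriceFlowEnclosureB12AsPrintedHistoryContagionShiftFlowZero (valueAtZero_sub_le rate_le_valueAtZero tail_le_invSprof)

noncomputable section

/-! ## §55 The chart offset of two trajectories near zero pin converges: the relative Λ-parameter -/

/-- Part 13 ∕ 14's smallness package transfers from a pin e′ to every smaller pin `0 < e ≤ e′`. [folklore] -/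
theorem package_of_le {Cm θ γ bs gs e e' : ℝ} (hCm : 0 ≤ Cm) (hθ1 : θ < 1) (hbs : 0 < bs) (hγ : 0 ≤ γ) (he : 0 < e) (hee' : e ≤ e')
    (hs1 : 4 * Cm * e' ≤ bs * (1 - θ))
    (hs2 : e' ^ 2 * (1 / gs ^ 2 + Cm * γ / (1 - θ) ^ 2 + (2 * Cm / ((1 - θ) * bs)) ^ 2) ≤ 3 / 4)
    (hs4 : 64 * Cm * e' ^ 3 ≤ (1 - θ) ^ 2) (hs5 : Cm * (8 * e' ^ 3 + 16 * e' / bs) ≤ (1 - θ) / 4) :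
    4 * Cm * e ≤ bs * (1 - θ) ∧ e ^ 2 * (1 / gs ^ 2 + Cm * γ / (1 - θ) ^ 2 + (2 * Cm / ((1 - θ) * bs)) ^ 2) ≤ 3 / 4 ∧
      64 * Cm * e ^ 3 ≤ (1 - θ) ^ 2 ∧ Cm * (8 * e ^ 3 + 16 * e / bs) ≤ (1 - θ) / 4 := by
  have h1θ : 0 < 1 - θ := by linarith
  have hQ0 : 0 ≤ 1 / gs ^ 2 + Cm * γ / (1 - θ) ^ 2 + (2 * Cm / ((1 - θ) * bs)) ^ 2 := by positivity
  have he3 : e ^ 3 ≤ e' ^ 3 := pow_le_pow_left₀ he.le hee' 3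
  refine ⟨(by nlinarith : 4 * Cm * e ≤ 4 * Cm * e').trans hs1,
    (mul_le_mul_of_nonneg_right (pow_le_pow_left₀ he.le hee' 2) hQ0).trans hs2,
    (mul_le_mul_of_nonneg_left he3 (by positivity)).trans hs4, ?_⟩
  have : Cm * (8 * e ^ 3 + 16 * e / bs) ≤ Cm * (8 * e' ^ 3 + 16 * e' / bs) := by
    refine mul_le_mul_of_nonneg_left ?_ hCm
    have := div_le_div_of_nonneg_right (show 16 * e ≤ 16 * e' by linarith) hbs.le
    linarith
  exact this.trans hs5

/-- **THE COMMON ENVELOPE.**  A box solution h from a pin `e ≤ e′` with part 10's smallness at e lies below the envelope of the LARGER pin: `h(m) ≤ c_m = (1∕(2e′)² + β*m∕4)^{−1∕2}`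
(part 10's profile `(2e, β*∕4)`, and `1∕(2e)² ≥ 1∕(2e′)²`). [folklore] -/
theorem le_envelope_of_reference_flow {B : (ℕ → ℝ) → ℝ} {Cm θ γ bs ta gs e e' : ℝ} {t h : ℕ → ℝ}
    (hB : MemoryProfile Cm θ γ B) (hCm : 0 ≤ Cm) (hθ0 : 0 ≤ θ) (hθ1 : θ < 1) (hbs : 0 < bs) (hta : 0 < ta)
    (hts : SeqBox γ t) (htf : MemFlow B gs t) (hprof : ∀ m : ℕ, 1 / ta ^ 2 + bs * (m : ℝ) ≤ 1 / (t m) ^ 2)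
    (he : 0 < e) (hee' : e ≤ e') (hhs : SeqBox γ h) (hhf : MemFlow B e h)
    (hs1 : 4 * Cm * e ≤ bs * (1 - θ))
    (hs2 : e ^ 2 * (1 / gs ^ 2 + Cm * γ / (1 - θ) ^ 2 + (2 * Cm / ((1 - θ) * bs)) ^ 2) ≤ 3 / 4) (m : ℕ) :
    h m ≤ 1 / sprof (2 * e') (bs / 4) m := by
  have he' : 0 < e' := he.trans_le hee'
  have hlow := invSq_lower_of_reference_flow hB hCm hθ0 hθ1 hbs hta hts htf hprof hhs hhf hs1 hs2 m
  have hcmp : 1 / (2 * e') ^ 2 ≤ 1 / (4 * e ^ 2) := by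
    rw [show (2 * e') ^ 2 = 4 * e' ^ 2 by ring]
    exact one_div_le_one_div_of_le (by positivity) (by nlinarith [pow_le_pow_left₀ he.le hee' 2])
  refine le_of_profile (one_div_sprof_pos (by positivity) (by positivity) m) (by positivity : (0 : ℝ) ≤ bs / 4) (hhs m).1 (m := 0) ?_
  rw [one_div_pow, one_div_one_div, sprof_sq (by positivity) (by positivity)]
  unfold T4CouplingMatching.prof
  simp only [Nat.cast_zero, mul_zero, add_zero]
  linarith

/-- **NEAR ZERO PIN THE RUNNING COUPLING DECREASES SCALE BY SCALE.**  `B` with memory profile `(C_m, θ)`, the value β₀ at the zero history, ONE AF reference (rate β*); a box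
solution h from a pin e with `4C_m e ≤ β*(1 − θ)` and part 10's `hs2`.  THEN `1∕h(m)² < 1∕h(m+1)²` and `h(m+1) < h(m) ≤ e` for every m: the memory term `B(h(m+1+·))` reads a tail
below 2e, where `B ≥ β₀ − 2C_m e∕(1 − θ) ≥ β₀ − β*∕2 > 0` (part 32's derived floor, `β* ≤ β₀`). [cite: Balaban1987RG1, Thm 2 (0.31) p.259 with (0.20) p.256] -/
theorem succ_le_of_reference_flow {B : (ℕ → ℝ) → ℝ} {Cm θ γ β₀ bs ta gs e : ℝ} {t h : ℕ → ℝ}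
    (hB : MemoryProfile Cm θ γ B) (hCm : 0 ≤ Cm) (hθ0 : 0 ≤ θ) (hθ1 : θ < 1) (hbs : 0 < bs) (hta : 0 < ta)
    (h0 : ∀ u : ℕ → ℝ, SeqBox γ u → |B u - β₀| ≤ Cm * ∑' j, θ ^ j * u j)
    (hts : SeqBox γ t) (htf : MemFlow B gs t) (hprof : ∀ m : ℕ, 1 / ta ^ 2 + bs * (m : ℝ) ≤ 1 / (t m) ^ 2)
    (hhs : SeqBox γ h) (hhf : MemFlow B e h)
    (hs1 : 4 * Cm * e ≤ bs * (1 - θ))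
    (hs2 : e ^ 2 * (1 / gs ^ 2 + Cm * γ / (1 - θ) ^ 2 + (2 * Cm / ((1 - θ) * bs)) ^ 2) ≤ 3 / 4) (m : ℕ) :
    1 / h m ^ 2 < 1 / h (m + 1) ^ 2 ∧ h (m + 1) < h m ∧ h m ≤ e := by
  have h1θ : 0 < 1 - θ := by linarith
  have he : 0 < e := by rw [← hhf.1]; exact (hhs 0).1
  have hβ := rate_le_valueAtZero hCm hθ0 hθ1 hbs hta h0 hts htf hprof
  have henv : ∀ q, h q ≤ 2 * e := fun q =>
    EriceFlowEnclosureB12AsPrintedHistoryContagionShiftFlow.le_two_mul_pin_of_reference_flow hB hCm hθ0 hθ1 hbs hta hts htf hprof hhs hhf hs1 hs2 q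
  -- every increment is positive
  have hinc : ∀ q, 1 / h q ^ 2 < 1 / h (q + 1) ^ 2 := by
    intro q
    have hfl := valueAtZero_sub_le (a := 2 * e) hCm hθ0 hθ1 h0 (seqBox_shift hhs (q + 1)) (fun j => henv (q + 1 + j))
    have hpos : 0 < β₀ - Cm * (2 * e) / (1 - θ) := by
      have : Cm * (2 * e) / (1 - θ) ≤ bs / 2 := by rw [div_le_iff₀ h1θ]; nlinarith
      linarith
    have e1 := hhf.2 q
    linarith
  have hdec : ∀ q, h (q + 1) < h q := by
    intro q
    have hq := (hhs q).1
    have hq1 := (hhs (q + 1)).1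
    have hsq : h (q + 1) ^ 2 < h q ^ 2 := (one_div_lt_one_div (pow_pos hq 2) (pow_pos hq1 2)).mp (hinc q)
    exact (pow_lt_pow_iff_left₀ hq1.le hq.le two_ne_zero).mp hsq
  refine ⟨hinc m, hdec m, ?_⟩
  have hanti : ∀ q, h q ≤ h 0 := by
    intro q
    induction q with
    | zero => exact le_rfl
    | succ q ih => exact (hdec q).le.trans ih
  rw [← hhf.1]
  exact hanti m

/-- **THE COUPLINGS OF TWO TRAJECTORIES DIFFER BY A CUBE OF THE ENVELOPE**: two box solutions h (pin e), h′ (pin e′), `e ≤ e′`, with part 14's package at e′, satisfy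
`|h(m) − h′(m)| ≤ (4∕3)·(1∕e² − 1∕e′²)·c_m³`, `c_m = (1∕(2e′)² + β*m∕4)^{−1∕2}` (node U2's `abs_sub_le_of_inv_sq`: `|h − h′| ≤ h²h′·|Δ|`, part 14's `|Δ(m)| ≤ (4∕3)Δ₀`, and
both trajectories below the common envelope). [cite: Balaban1987RG1, Thm 2 (0.31) p.259 with (0.20) p.256] -/
theorem abs_sub_le_cube {B : (ℕ → ℝ) → ℝ} {Cm θ γ bs ta gs e e' : ℝ} {t h h' : ℕ → ℝ}
    (hB : MemoryProfile Cm θ γ B) (hCm : 0 ≤ Cm) (hθ0 : 0 ≤ θ) (hθ1 : θ < 1) (hbs : 0 < bs) (hta : 0 < ta)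
    (hts : SeqBox γ t) (htf : MemFlow B gs t) (hprof : ∀ m : ℕ, 1 / ta ^ 2 + bs * (m : ℝ) ≤ 1 / (t m) ^ 2)
    (he : 0 < e) (hee' : e ≤ e') (h2e' : 2 * e' ≤ γ)
    (hs1 : 4 * Cm * e' ≤ bs * (1 - θ))
    (hs2 : e' ^ 2 * (1 / gs ^ 2 + Cm * γ / (1 - θ) ^ 2 + (2 * Cm / ((1 - θ) * bs)) ^ 2) ≤ 3 / 4)
    (hs4 : 64 * Cm * e' ^ 3 ≤ (1 - θ) ^ 2) (hs5 : Cm * (8 * e' ^ 3 + 16 * e' / bs) ≤ (1 - θ) / 4)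
    (hhs : SeqBox γ h) (hhf : MemFlow B e h) (hhs' : SeqBox γ h') (hhf' : MemFlow B e' h') (m : ℕ) :
    |h m - h' m| ≤ 4 / 3 * (1 / e ^ 2 - 1 / e' ^ 2) * (1 / sprof (2 * e') (bs / 4) m) ^ 3 := by
  have he' : 0 < e' := he.trans_le hee'
  have hγ : 0 ≤ γ := by linarith
  obtain ⟨hs1e, hs2e, -, -⟩ := package_of_le hCm hθ1 hbs hγ he hee' hs1 hs2 hs4 hs5
  have hk := sep_twoSided_of_reference_flow hB hCm hθ0 hθ1 hbs hta hts htf hprof he hee' h2e' hs1 hs2 hs4 hs5 hhs hhf hhs' hhf' m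
  have hΔ0 : 0 ≤ 1 / e ^ 2 - 1 / e' ^ 2 := by
    rw [sub_nonneg]; exact one_div_le_one_div_of_le (by positivity) (pow_le_pow_left₀ he.le hee' 2)
  have habs : |1 / (h m) ^ 2 - 1 / (h' m) ^ 2| ≤ 4 / 3 * (1 / e ^ 2 - 1 / e' ^ 2) := by
    rw [abs_le]; constructor <;> linarith [hk.1, hk.2]
  have hq := (hhs m).1
  have hq' := (hhs' m).1
  have hc0 := one_div_sprof_pos (by positivity : (0 : ℝ) < 2 * e') (by positivity : (0 : ℝ) ≤ bs / 4) m
  have hhc : h m ≤ 1 / sprof (2 * e') (bs / 4) m :=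
    le_envelope_of_reference_flow hB hCm hθ0 hθ1 hbs hta hts htf hprof he hee' hhs hhf hs1e hs2e m
  have hhc' : h' m ≤ 1 / sprof (2 * e') (bs / 4) m :=
    le_envelope_of_reference_flow hB hCm hθ0 hθ1 hbs hta hts htf hprof he' le_rfl hhs' hhf' hs1 hs2 m
  have h1 := abs_sub_le_of_inv_sq hq hq'
  have h2 : (h m) ^ 2 * h' m ≤ (1 / sprof (2 * e') (bs / 4) m) ^ 3 := by
    calc (h m) ^ 2 * h' m ≤ (1 / sprof (2 * e') (bs / 4) m) ^ 2 * (1 / sprof (2 * e') (bs / 4) m) :=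
          mul_le_mul (pow_le_pow_left₀ hq.le hhc 2) hhc' hq'.le (by positivity)
      _ = _ := by ring
  calc |h m - h' m| ≤ (h m) ^ 2 * h' m * |1 / (h m) ^ 2 - 1 / (h' m) ^ 2| := h1
    _ ≤ (1 / sprof (2 * e') (bs / 4) m) ^ 3 * (4 / 3 * (1 / e ^ 2 - 1 / e' ^ 2)) :=
        mul_le_mul h2 habs (abs_nonneg _) (by positivity)
    _ = _ := by ring

/-- **THE CUBE OF THE ENVELOPE TELESCOPES**: `c_{m+1}³ ≤ (2∕b)·(c_m − c_{m+1})` for `c_m = 1∕√(1∕t_a² + b·m)` (`1∕p − 1∕q = b∕((p + q)pq) ≥ b∕(2q³)` with p = √a_m ≤ q = √a_{m+1},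
`q² − p² = b`) — the discrete form of `∫ x^{−3∕2} = −2x^{−1∕2}`. [folklore] -/
theorem cube_le_telescope {ta b : ℝ} (hta : 0 < ta) (hb : 0 < b) (m : ℕ) :
    (1 / sprof ta b (m + 1)) ^ 3 ≤ 2 / b * (1 / sprof ta b m - 1 / sprof ta b (m + 1)) := by
  set p := sprof ta b m with hp
  set q := sprof ta b (m + 1) with hq
  have hp0 : 0 < p := sprof_pos hta hb.le m
  have hq0 : 0 < q := sprof_pos hta hb.le (m + 1)
  have hpq : p ≤ q := sprof_le_sprof hb.le (Nat.le_succ m)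
  have hd : q ^ 2 - p ^ 2 = b := T4CouplingMatching.sprof_sq_diff hta hb.le m
  have e1 : 1 / p - 1 / q = b / ((q + p) * (p * q)) := by
    field_simp
    nlinarith [hd]
  rw [e1, show 2 / b * (b / ((q + p) * (p * q))) = 2 / ((q + p) * (p * q)) by field_simp,
    div_pow, one_pow, div_le_div_iff₀ (by positivity) (by positivity), one_mul]
  -- `(q + p)·p·q ≤ 2q³`
  have : (q + p) * (p * q) ≤ 2 * q ^ 3 := by nlinarith [mul_pos hp0 hq0, mul_le_mul hpq hpq hp0.le hq0.le]
  linarith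

/-- **ONE STEP OF THE OFFSET.**  Under the data of `abs_sub_le_cube`, the chart offset `D(n) = 1∕h(n)² − 1∕h′(n)²` moves by at most
`(4C_m∕(3(1 − θ)))·Δ₀·c_{n+1}³` from n to n+1: its increment is `B(h(n+1+·)) − B(h′(n+1+·))`, controlled by the memory profile against couplings that differ by
`(4∕3)Δ₀c³` beyond scale n+1 (c decreasing). [cite: Balaban1987RG1, Thm 2 (0.31) p.259 with (0.20) p.256 and p.298] -/
theorem abs_disc_succ_sub_le {B : (ℕ → ℝ) → ℝ} {Cm θ γ bs ta gs e e' : ℝ} {t h h' : ℕ → ℝ}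
    (hB : MemoryProfile Cm θ γ B) (hCm : 0 ≤ Cm) (hθ0 : 0 ≤ θ) (hθ1 : θ < 1) (hbs : 0 < bs) (hta : 0 < ta)
    (hts : SeqBox γ t) (htf : MemFlow B gs t) (hprof : ∀ m : ℕ, 1 / ta ^ 2 + bs * (m : ℝ) ≤ 1 / (t m) ^ 2)
    (he : 0 < e) (hee' : e ≤ e') (h2e' : 2 * e' ≤ γ)
    (hs1 : 4 * Cm * e' ≤ bs * (1 - θ))
    (hs2 : e' ^ 2 * (1 / gs ^ 2 + Cm * γ / (1 - θ) ^ 2 + (2 * Cm / ((1 - θ) * bs)) ^ 2) ≤ 3 / 4)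
    (hs4 : 64 * Cm * e' ^ 3 ≤ (1 - θ) ^ 2) (hs5 : Cm * (8 * e' ^ 3 + 16 * e' / bs) ≤ (1 - θ) / 4)
    (hhs : SeqBox γ h) (hhf : MemFlow B e h) (hhs' : SeqBox γ h') (hhf' : MemFlow B e' h') (n : ℕ) :
    |(1 / h (n + 1) ^ 2 - 1 / h' (n + 1) ^ 2) - (1 / h n ^ 2 - 1 / h' n ^ 2)|
      ≤ 4 * Cm / (3 * (1 - θ)) * (1 / e ^ 2 - 1 / e' ^ 2) * (1 / sprof (2 * e') (bs / 4) (n + 1)) ^ 3 := by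
  have h1θ : 0 < 1 - θ := by linarith
  have he' : 0 < e' := he.trans_le hee'
  have hΔ0 : 0 ≤ 1 / e ^ 2 - 1 / e' ^ 2 := by
    rw [sub_nonneg]; exact one_div_le_one_div_of_le (by positivity) (pow_le_pow_left₀ he.le hee' 2)
  set c : ℕ → ℝ := fun m => 1 / sprof (2 * e') (bs / 4) m with hc
  have hc0 : ∀ m, 0 < c m := fun m => one_div_sprof_pos (by positivity) (by positivity) m
  have hcmono : ∀ m m', m ≤ m' → c m' ≤ c m := fun m m' hmm' =>
    one_div_le_one_div_of_le (sprof_pos (by positivity) (by positivity) m) (sprof_le_sprof (by positivity) hmm')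
  -- the increment is a difference of memory terms
  have e1 : (1 / h (n + 1) ^ 2 - 1 / h' (n + 1) ^ 2) - (1 / h n ^ 2 - 1 / h' n ^ 2)
      = B (fun j => h (n + 1 + j)) - B (fun j => h' (n + 1 + j)) := by
    rw [hhf.2 n, hhf'.2 n]; ring
  rw [e1]
  have hprofile := hB _ _ (seqBox_shift hhs (n + 1)) (seqBox_shift hhs' (n + 1))
  set K : ℝ := 4 / 3 * (1 / e ^ 2 - 1 / e' ^ 2) * c (n + 1) ^ 3 with hK
  have hK0 : 0 ≤ K := mul_nonneg (mul_nonneg (by norm_num) hΔ0) (pow_nonneg (hc0 _).le 3)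
  have hpt : ∀ j, θ ^ j * |h (n + 1 + j) - h' (n + 1 + j)| ≤ θ ^ j * K := by
    intro j
    refine mul_le_mul_of_nonneg_left ?_ (pow_nonneg hθ0 j)
    have h1 := abs_sub_le_cube hB hCm hθ0 hθ1 hbs hta hts htf hprof he hee' h2e' hs1 hs2 hs4 hs5 hhs hhf hhs' hhf' (n + 1 + j)
    have h2 : (1 / sprof (2 * e') (bs / 4) (n + 1 + j)) ^ 3 ≤ c (n + 1) ^ 3 :=
      pow_le_pow_left₀ (hc0 _).le (hcmono _ _ (Nat.le_add_right _ _)) 3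
    exact h1.trans (mul_le_mul_of_nonneg_left h2 (mul_nonneg (by norm_num) hΔ0))
  have hsum : ∑' j, θ ^ j * |h (n + 1 + j) - h' (n + 1 + j)| ≤ K / (1 - θ) := by
    have hs1' := summable_profile hθ0 hθ1 (seqBox_shift hhs (n + 1)) (seqBox_shift hhs' (n + 1))
    have hs2' : Summable fun j : ℕ => θ ^ j * K := (summable_geometric_of_lt_one hθ0 hθ1).mul_right K
    calc ∑' j, θ ^ j * |h (n + 1 + j) - h' (n + 1 + j)| ≤ ∑' j : ℕ, θ ^ j * K := hs1'.tsum_le_tsum hpt hs2'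
      _ = K / (1 - θ) := by rw [tsum_mul_right, tsum_geometric_of_lt_one hθ0 hθ1]; ring
  calc |B (fun j => h (n + 1 + j)) - B (fun j => h' (n + 1 + j))| ≤ Cm * ∑' j, θ ^ j * |h (n + 1 + j) - h' (n + 1 + j)| := hprofile
    _ ≤ Cm * (K / (1 - θ)) := mul_le_mul_of_nonneg_left hsum hCm
    _ = _ := by simp only [hK, hc]; field_simp

/-- **THE OFFSET IS CAUCHY WITH AN EXPLICIT RATE.**  Under the data of `abs_sub_le_cube`, for all `n ≤ N`:
**`|D(N) − D(n)| ≤ (32C_m∕(3(1 − θ)β*))·Δ₀·(c_n − c_N) ≤ (32C_m∕(3(1 − θ)β*))·Δ₀·c_n`**, `D(m) = 1∕h(m)² − 1∕h′(m)²`, `Δ₀ = 1∕e² − 1∕e′²`, `c_m = (1∕(2e′)² + β*m∕4)^{−1∕2}`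
(one step + `cube_le_telescope`, summed). [cite: Balaban1987RG1, Thm 2 (0.31) p.259 with (0.20) p.256 and p.298] -/
theorem abs_disc_sub_disc_le {B : (ℕ → ℝ) → ℝ} {Cm θ γ bs ta gs e e' : ℝ} {t h h' : ℕ → ℝ}
    (hB : MemoryProfile Cm θ γ B) (hCm : 0 ≤ Cm) (hθ0 : 0 ≤ θ) (hθ1 : θ < 1) (hbs : 0 < bs) (hta : 0 < ta)
    (hts : SeqBox γ t) (htf : MemFlow B gs t) (hprof : ∀ m : ℕ, 1 / ta ^ 2 + bs * (m : ℝ) ≤ 1 / (t m) ^ 2)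
    (he : 0 < e) (hee' : e ≤ e') (h2e' : 2 * e' ≤ γ)
    (hs1 : 4 * Cm * e' ≤ bs * (1 - θ))
    (hs2 : e' ^ 2 * (1 / gs ^ 2 + Cm * γ / (1 - θ) ^ 2 + (2 * Cm / ((1 - θ) * bs)) ^ 2) ≤ 3 / 4)
    (hs4 : 64 * Cm * e' ^ 3 ≤ (1 - θ) ^ 2) (hs5 : Cm * (8 * e' ^ 3 + 16 * e' / bs) ≤ (1 - θ) / 4)
    (hhs : SeqBox γ h) (hhf : MemFlow B e h) (hhs' : SeqBox γ h') (hhf' : MemFlow B e' h') {n N : ℕ} (hnN : n ≤ N) :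
    |(1 / h N ^ 2 - 1 / h' N ^ 2) - (1 / h n ^ 2 - 1 / h' n ^ 2)|
      ≤ 32 * Cm / (3 * (1 - θ) * bs) * (1 / e ^ 2 - 1 / e' ^ 2) * (1 / sprof (2 * e') (bs / 4) n - 1 / sprof (2 * e') (bs / 4) N) := by
  have h1θ : 0 < 1 - θ := by linarith
  have he' : 0 < e' := he.trans_le hee'
  have hΔ0 : 0 ≤ 1 / e ^ 2 - 1 / e' ^ 2 := by
    rw [sub_nonneg]; exact one_div_le_one_div_of_le (by positivity) (pow_le_pow_left₀ he.le hee' 2)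
  set c : ℕ → ℝ := fun m => 1 / sprof (2 * e') (bs / 4) m with hc
  set D : ℕ → ℝ := fun m => 1 / h m ^ 2 - 1 / h' m ^ 2 with hD
  have htel : ∀ m, c (m + 1) ^ 3 ≤ 2 / (bs / 4) * (c m - c (m + 1)) := fun m =>
    cube_le_telescope (by positivity : (0 : ℝ) < 2 * e') (by positivity : (0 : ℝ) < bs / 4) m
  have hstep : ∀ m, |D (m + 1) - D m| ≤ 4 * Cm / (3 * (1 - θ)) * (1 / e ^ 2 - 1 / e' ^ 2) * c (m + 1) ^ 3 := fun m =>
    abs_disc_succ_sub_le hB hCm hθ0 hθ1 hbs hta hts htf hprof he hee' h2e' hs1 hs2 hs4 hs5 hhs hhf hhs' hhf' m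
  -- induction on N from n
  obtain ⟨d, rfl⟩ := Nat.exists_eq_add_of_le hnN
  show |D (n + d) - D n| ≤ 32 * Cm / (3 * (1 - θ) * bs) * (1 / e ^ 2 - 1 / e' ^ 2) * (c n - c (n + d))
  induction d with
  | zero => simp
  | succ d ih =>
    have h1 := hstep (n + d)
    have h2 := htel (n + d)
    rw [show n + (d + 1) = n + d + 1 by omega]
    have hA : 0 ≤ 4 * Cm / (3 * (1 - θ)) * (1 / e ^ 2 - 1 / e' ^ 2) := mul_nonneg (by positivity) hΔ0
    have h3 : 4 * Cm / (3 * (1 - θ)) * (1 / e ^ 2 - 1 / e' ^ 2) * c (n + d + 1) ^ 3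
        ≤ 32 * Cm / (3 * (1 - θ) * bs) * (1 / e ^ 2 - 1 / e' ^ 2) * (c (n + d) - c (n + d + 1)) := by
      calc 4 * Cm / (3 * (1 - θ)) * (1 / e ^ 2 - 1 / e' ^ 2) * c (n + d + 1) ^ 3
          ≤ 4 * Cm / (3 * (1 - θ)) * (1 / e ^ 2 - 1 / e' ^ 2) * (2 / (bs / 4) * (c (n + d) - c (n + d + 1))) :=
            mul_le_mul_of_nonneg_left h2 hA
        _ = _ := by field_simp; ring
    calc |D (n + d + 1) - D n| = |(D (n + d + 1) - D (n + d)) + (D (n + d) - D n)| := by ring_nf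
      _ ≤ |D (n + d + 1) - D (n + d)| + |D (n + d) - D n| := abs_add_le _ _
      _ ≤ 32 * Cm / (3 * (1 - θ) * bs) * (1 / e ^ 2 - 1 / e' ^ 2) * (c (n + d) - c (n + d + 1))
          + 32 * Cm / (3 * (1 - θ) * bs) * (1 / e ^ 2 - 1 / e' ^ 2) * (c n - c (n + d)) :=
            add_le_add (h1.trans h3) (ih (Nat.le_add_right _ _))
      _ = _ := by ring

/-- **THE RELATIVE Λ-PARAMETER OF TWO TRAJECTORIES NEAR ZERO PIN EXISTS.**  `B` with memory profile `(C_m, θ)` on ]0, γ]^ℕ (0 ≤ θ < 1, C_m ≥ 0); ONE AF reference t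
(`MemFlow B g* t`, `1∕t_a² + β*·m ≤ 1∕t(m)²`); pins `0 < e ≤ e′` with part 14's package at e′ (`2e′ ≤ γ`, `4C_m e′ ≤ β*(1 − θ)`, `e′²·Q ≤ 3∕4`, `64C_m e′³ ≤ (1 − θ)²`,
`C_m(8e′³ + 16e′∕β*) ≤ (1 − θ)∕4`); box solutions h from e, h′ from e′.  THEN the chart offset converges: **`1∕h(n)² − 1∕h′(n)² → Θ`** with
**`(2∕3)(1∕e² − 1∕e′²) ≤ Θ ≤ (4∕3)(1∕e² − 1∕e′²)`** and the rate **`|Θ − (1∕h(n)² − 1∕h′(n)²)| ≤ (32C_m∕(3(1 − θ)β*))·(1∕e² − 1∕e′²)·(1∕(2e′)² + β*n∕4)^{−1∕2}`** — THE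
RELATIVE Λ-PARAMETER of the two trajectories, floor-free. [cite: Balaban1987RG1, Thm 2 (0.31) p.259 with (0.20) p.256 and p.298] -/
theorem exists_relativeLambda {B : (ℕ → ℝ) → ℝ} {Cm θ γ bs ta gs e e' : ℝ} {t h h' : ℕ → ℝ}
    (hB : MemoryProfile Cm θ γ B) (hCm : 0 ≤ Cm) (hθ0 : 0 ≤ θ) (hθ1 : θ < 1) (hbs : 0 < bs) (hta : 0 < ta)
    (hts : SeqBox γ t) (htf : MemFlow B gs t) (hprof : ∀ m : ℕ, 1 / ta ^ 2 + bs * (m : ℝ) ≤ 1 / (t m) ^ 2)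
    (he : 0 < e) (hee' : e ≤ e') (h2e' : 2 * e' ≤ γ)
    (hs1 : 4 * Cm * e' ≤ bs * (1 - θ))
    (hs2 : e' ^ 2 * (1 / gs ^ 2 + Cm * γ / (1 - θ) ^ 2 + (2 * Cm / ((1 - θ) * bs)) ^ 2) ≤ 3 / 4)
    (hs4 : 64 * Cm * e' ^ 3 ≤ (1 - θ) ^ 2) (hs5 : Cm * (8 * e' ^ 3 + 16 * e' / bs) ≤ (1 - θ) / 4)
    (hhs : SeqBox γ h) (hhf : MemFlow B e h) (hhs' : SeqBox γ h') (hhf' : MemFlow B e' h') :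
    ∃ Θ : ℝ, Tendsto (fun n => 1 / h n ^ 2 - 1 / h' n ^ 2) atTop (𝓝 Θ) ∧
      2 / 3 * (1 / e ^ 2 - 1 / e' ^ 2) ≤ Θ ∧ Θ ≤ 4 / 3 * (1 / e ^ 2 - 1 / e' ^ 2) ∧
      ∀ n : ℕ, |Θ - (1 / h n ^ 2 - 1 / h' n ^ 2)| ≤ 32 * Cm / (3 * (1 - θ) * bs) * (1 / e ^ 2 - 1 / e' ^ 2) * (1 / sprof (2 * e') (bs / 4) n) := by
  have h1θ : 0 < 1 - θ := by linarith
  have he' : 0 < e' := he.trans_le hee'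
  have hΔ0 : 0 ≤ 1 / e ^ 2 - 1 / e' ^ 2 := by
    rw [sub_nonneg]; exact one_div_le_one_div_of_le (by positivity) (pow_le_pow_left₀ he.le hee' 2)
  set c : ℕ → ℝ := fun m => 1 / sprof (2 * e') (bs / 4) m with hc
  set D : ℕ → ℝ := fun m => 1 / h m ^ 2 - 1 / h' m ^ 2 with hD
  set K : ℝ := 32 * Cm / (3 * (1 - θ) * bs) * (1 / e ^ 2 - 1 / e' ^ 2) with hK
  have hK0 : 0 ≤ K := mul_nonneg (by positivity) hΔ0
  have hc0 : ∀ m, 0 < c m := fun m => one_div_sprof_pos (by positivity) (by positivity) m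
  have htail : ∀ n N, n ≤ N → |D N - D n| ≤ K * c n := by
    intro n N hnN
    have h := abs_disc_sub_disc_le hB hCm hθ0 hθ1 hbs hta hts htf hprof he hee' h2e' hs1 hs2 hs4 hs5 hhs hhf hhs' hhf' hnN
    have : K * (c n - c N) ≤ K * c n := by nlinarith [hc0 N]
    exact h.trans this
  -- Cauchy, hence convergent
  have hcauchy : CauchySeq D := by
    refine Metric.cauchySeq_iff'.mpr fun ε hε => ?_
    obtain ⟨n₀, hn₀⟩ := exists_tail_scale_le (show (0 : ℝ) < 2 * e' by positivity) (show (0 : ℝ) < bs / 4 by positivity)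
      (show 0 < ε / (K + 1) by positivity)
    refine ⟨n₀, fun n hn => ?_⟩
    rw [Real.dist_eq]
    have h1 := htail n₀ n hn
    have h2 : K * c n₀ ≤ K * (ε / (K + 1)) := mul_le_mul_of_nonneg_left (hn₀ n₀ le_rfl) hK0
    have h3 : K * (ε / (K + 1)) < ε := by
      rw [← mul_div_assoc, div_lt_iff₀ (by positivity)]; nlinarith
    linarith
  obtain ⟨Θ, hΘ⟩ := cauchySeq_tendsto_of_complete hcauchy
  refine ⟨Θ, hΘ, ?_, ?_, fun n => ?_⟩
  · exact ge_of_tendsto' hΘ fun n =>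
      (sep_twoSided_of_reference_flow hB hCm hθ0 hθ1 hbs hta hts htf hprof he hee' h2e' hs1 hs2 hs4 hs5 hhs hhf hhs' hhf' n).1
  · exact le_of_tendsto' hΘ fun n =>
      (sep_twoSided_of_reference_flow hB hCm hθ0 hθ1 hbs hta hts htf hprof he hee' h2e' hs1 hs2 hs4 hs5 hhs hhf hhs' hhf' n).2
  · have hlim : Tendsto (fun N => |D N - D n|) atTop (𝓝 |Θ - D n|) := (hΘ.sub_const (D n)).abs
    exact le_of_tendsto hlim (Filter.eventually_atTop.mpr ⟨n, fun N hnN => htail n N hnN⟩)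

end

end Summit.QuantumFields.BalabanUV.Beta.EriceFlowEnclosureB12AsPrintedHistoryContagionShiftFlowZeroOffset
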